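import Mathlib
import Literature.Analysis.FluidPDE.ClassicalSolution
import Literature.Analysis.FluidPDE.VectorCalculus
import Summits.NavierStokesRegularity.NavierStokesRegularity.Theses.ThreadingFlux

/-! # Sketch — crux idea «reynolds-quadrupole-threading» for `PoloidalLiouville` (stmt-NavierStokesRegularity-1222)
Typed first lemmas (Props only; nothing is proved here).  y = x − x₀, r = ‖y‖, F = ⟪curl u, y⟫ (threading flux).
The l = 2 poloidal shell with χ-profile `h` and traceless symmetric shape tensor `Q`:
`u = curl curl (h(r)⟪y,Qy⟫ y) = (−2h'(r)/r ⟪y,Qy⟫) y + 2(3h + r h') Q y`, toroidal potential `T = E(r)⟪y,Qy⟫`,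
`E = −(h'' + 6h'/r)`.  ORDER-TWO NORMAL FORM (engine-certified, validated against kit job j308398 to 6 digits):
`∂ₜ² F |_{t₀} = κ[h](r) · det(y, Qy, Q²y)`, `κ = E · Ξ[h]`, with `Ξ` the explicit local + pressure-multipole functional below,
and FAR-FIELD SIGN: `r⁵ Ξ[h](r) → −(36/5)·(20/7)∫₀^∞ t⁶ h'(t)² dt < 0`.  NS regularity is NOT proved by any of this.

v2 (ns-idea-15 g2, 2026-08-28; prices of verdicts V52/V2 paid): P1 — the pressure binder is now SUBLINEAR GROWTH
`p(t,x)/(1+‖x−x₀‖) → 0` (fixes `p` up to a constant, which `∂ₜ²F` never sees), so the bounded non-decaying endpoint `σ = 1` is a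
NON-EMPTY case of `L2ShellRung`; its coefficient `Z(1) = −64` is the LOCAL horizon law of the companion card «horizon-threading-tower»
(`κ → E·Ξ = (4c r⁻³)(−64 c² r⁻²) = −256 c³ r⁻⁵ = 𝔏₂/r²`, pressure part zero).  P2/A1 — smoothness classes are written DELIBERATELY:
`ω` (analytic, `(⊤ : WithTop ℕ∞)`) in `SecondJetNormalForm` / `L2ShellRung` (slices of bounded classical NS solutions are spatially
analytic, cf. `IsTypeIAncientMild.analyticOnNhd_slice_univ`; under `ω` the exterior-irrotational glued configuration `h' = C r⁻⁶` on
`[R,∞)`, `E ≢ 0` inside, is excluded by the identity theorem for `r⁶h' − C` on `(0,∞)`, and the global `a + b r⁻⁵` by smoothness at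
`0`; the `C^∞` version of the rung is a different statement, NOT claimed), `∞` (`((⊤ : ℕ∞) : WithTop ℕ∞)`) where analyticity is
irrelevant.  P3 — degree-dependent tails `HasFastTailDeg l` in the general-degree Props.  A3 — the unused binder `t⁵h² → 0` is
dropped from `QuadrupoleMomentIdentity` (the `18 t⁵ h h'` terms cancel exactly).  A4 — `L2ShellRung` has no runnable falsifier at
rung level (no window rung has); falsifiers are lemma-level (`FarFieldSign` numerics, `QuadrupoleMomentIdentity` symbolic, `ZexpNeg`
by Sturm — critic A5).  A5 — `ZexpNeg` recorded as a Prop (Sturm-certified by the critic; Lean proof = typer task). -/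

set_option linter.dupNamespace false

namespace Summit.NavierStokesRegularity.NavierStokesRegularity.Cruxes.PoloidalLiouville.ReynoldsQuadrupole

open scoped Topology
open Filter Set MeasureTheory

/-- ℝ³. -/
abbrev E3 : Type := EuclideanSpace ℝ (Fin 3)

/-- The `l = 2` poloidal shell about `x₀` with χ-profile `h` and shape tensor `Q`. -/
noncomputable def shellVelocity (h : ℝ → ℝ) (Q : E3 →L[ℝ] E3) (x₀ : E3) : E3 → E3 := fun x =>
  (-2 * deriv h ‖x - x₀‖ / ‖x - x₀‖ * inner ℝ (x - x₀) (Q (x - x₀))) • (x - x₀)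
    + (2 * (3 * h ‖x - x₀‖ + ‖x - x₀‖ * deriv h ‖x - x₀‖)) • Q (x - x₀)

/-- Traceless symmetric shape tensor (so that `⟪y, Qy⟫` is a harmonic quadratic). -/
def IsShapeTensor (Q : E3 →L[ℝ] E3) : Prop :=
  (∀ a b : E3, inner ℝ (Q a) b = inner ℝ a (Q b)) ∧ LinearMap.trace ℝ E3 (Q : E3 →ₗ[ℝ] E3) = 0

/-- The Vandermonde covariant `det(y, Qy, Q²y)` — the unique cubic `V₃`-channel of `Sym³(V₂)`; it vanishes identically
iff `Q` has a repeated eigenvalue (uniaxial = axisymmetric shell). -/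
noncomputable def vandermondeCovariant (Q : E3 →L[ℝ] E3) (y : E3) : ℝ :=
  inner ℝ y (Literature.Analysis.FluidPDE.cross (Q y) (Q (Q y)))

/-- Threading flux `F(t,x) = ⟪curl u(t) x, x − x₀⟫`. -/
noncomputable def threadingFlux (u : ℝ → E3 → E3) (x₀ : E3) (t : ℝ) (x : E3) : ℝ :=
  inner ℝ (Literature.Analysis.FluidPDE.curl (u t) x) (x - x₀)

/-- Quadrupole (`Y₂₀`-channel) profile of the pressure source `−∂ᵢuⱼ∂ⱼuᵢ` of the shell. -/
noncomputable def quadSource (h : ℝ → ℝ) (t : ℝ) : ℝ :=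
  8 * (18 * h t * deriv h t + 3 * h t * deriv (deriv h) t * t + 2 * (deriv h t) ^ 2 * t
      - deriv h t * deriv (deriv h) t * t ^ 2) / (7 * t)

/-- Hexadecapole (`Y₄`-channel) profile of the pressure source of the shell. -/
noncomputable def hexSource (h : ℝ → ℝ) (t : ℝ) : ℝ :=
  -4 * (3 * h t * deriv h t - 3 * h t * deriv (deriv h) t * t + 12 * (deriv h t) ^ 2 * t
      + deriv h t * deriv (deriv h) t * t ^ 2) / t ^ 3

/-- `P₂'`, `P₂`: the exterior-decaying solution of `P₂'' + 6P₂'/r = quadSource h`. -/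
noncomputable def dP2 (h : ℝ → ℝ) (r : ℝ) : ℝ := (∫ t in (0 : ℝ)..r, t ^ 6 * quadSource h t) / r ^ 6
noncomputable def P2 (h : ℝ → ℝ) (r : ℝ) : ℝ := -∫ t in Set.Ioi r, dP2 h t
/-- `P₄'`, `P₄`: the exterior-decaying solution of `P₄'' + 10P₄'/r = hexSource h`. -/
noncomputable def dP4 (h : ℝ → ℝ) (r : ℝ) : ℝ := (∫ t in (0 : ℝ)..r, t ^ 10 * hexSource h t) / r ^ 10
noncomputable def P4 (h : ℝ → ℝ) (r : ℝ) : ℝ := -∫ t in Set.Ioi r, dP4 h t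

/-- `Ξ[h](r)`: local part `−16(3h + r h')²` plus the quadrupole and hexadecapole pressure parts. -/
noncomputable def Xi (h : ℝ → ℝ) (r : ℝ) : ℝ :=
  -16 * (3 * h r + r * deriv h r) ^ 2 - 12 * (r * dP2 h r + 2 * P2 h r)
    - 32 / 7 * r ^ 2 * (r * dP4 h r + 4 * P4 h r)

/-- `κ[h] = E · Ξ[h]`, `E = −(h'' + 6h'/r)` (the toroidal-potential profile). -/
noncomputable def kappa (h : ℝ → ℝ) (r : ℝ) : ℝ := -(deriv (deriv h) r + 6 * deriv h r / r) * Xi h r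

/-- Admissible FAST tail: `h⁽ᵏ⁾(t) = O(t^{−5/2−ε−k})`, `k ≤ 3`. -/
def HasFastTail (h : ℝ → ℝ) : Prop :=
  ∃ C ε : ℝ, 0 < ε ∧ ∀ k ≤ 3, ∀ t : ℝ, 1 ≤ t → |iteratedDeriv k h t| ≤ C * t ^ (-(5 / 2 + ε + k) : ℝ)

/-- Degree-dependent admissible FAST tail (P3): `h⁽ᵏ⁾(t) = O(t^{−l−1/2−ε−k})`, `k ≤ 3` — exactly what makes the Reynolds radial
factor `∫₀^∞ t^{2l+2} h'(t)² dt` converge; `HasFastTail = HasFastTailDeg 2` in content. -/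
def HasFastTailDeg (l : ℕ) (h : ℝ → ℝ) : Prop :=
  ∃ C ε : ℝ, 0 < ε ∧ ∀ k ≤ 3, ∀ t : ℝ, 1 ≤ t → |iteratedDeriv k h t| ≤ C * t ^ (-((l : ℝ) + 1 / 2 + ε + k))

/-- Admissible POWER tail: `h ~ c t^{−σ}` with `1 ≤ σ < 5/2`, `c ≠ 0`, differentiated twice (σ = 1: bounded
non-decaying shell — the regime of the bounded ancient class). -/
def HasPowerTail (h : ℝ → ℝ) (c σ : ℝ) : Prop :=
  c ≠ 0 ∧ 1 ≤ σ ∧ σ < 5 / 2 ∧ Tendsto (fun t : ℝ => t ^ σ * h t) atTop (𝓝 c) ∧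
    Tendsto (fun t : ℝ => t ^ (σ + 1) * deriv h t) atTop (𝓝 (-σ * c)) ∧
    Tendsto (fun t : ℝ => t ^ (σ + 2) * deriv (deriv h) t) atTop (𝓝 (σ * (σ + 1) * c))

/-- The exponent polynomial of the power-tail regime: `r^{2σ} Ξ → c² Z(σ)`; `Z < 0` on `[1, 5/2)`
(numerator maximum −0.279 at σ ≈ 1.868; Z(1) = −64, Z(3/2) = −18, Z(2) = −16/3). -/
noncomputable def Zexp (σ : ℝ) : ℝ :=
  16 * (22 * σ ^ 4 - 147 * σ ^ 3 + 203 * σ ^ 2 + 207 * σ - 405) / ((σ + 1) * (2 * σ - 7) * (2 * σ - 5))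

/-- SIGN CERTIFICATE (A5; S): the numerator of `Z` is negative on the whole power-tail window `[1, 5/2]` (exact rational Sturm
sequence: no root in `(1, 5/2]`, `N(1) = −120`, `N(5/2) = −225/4`; grid maximum `−0.2790` at `σ ≈ 1.869` — certified by the critic of
record, ns-wall-crit-1 V2-A5), and the denominator is positive there; hence `Z < 0` on `[1, 5/2)`. -/
def ZexpNeg : Prop :=
  ∀ σ : ℝ, 1 ≤ σ → σ ≤ 5 / 2 → 22 * σ ^ 4 - 147 * σ ^ 3 + 203 * σ ^ 2 + 207 * σ - 405 < 0

/-- FIRST LEMMA (provable now, S–M; integration by parts, sympy-certified):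
`U₂(∞) := ∫₀^∞ t⁶ s₂[h] = (20/7) ∫₀^∞ t⁶ h'(t)² dt` — POSITIVE for every non-constant profile. -/
def QuadrupoleMomentIdentity : Prop :=
  ∀ h : ℝ → ℝ, ContDiff ℝ 2 h →
    IntegrableOn (fun t : ℝ => t ^ 6 * (deriv h t) ^ 2) (Set.Ioi 0) →
    Tendsto (fun t : ℝ => t ^ 6 * h t * deriv h t) atTop (𝓝 0) →
    Tendsto (fun t : ℝ => t ^ 7 * (deriv h t) ^ 2) atTop (𝓝 0) →
    Tendsto (fun R : ℝ => ∫ t in (0 : ℝ)..R, t ^ 6 * quadSource h t) atTop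
      (𝓝 (20 / 7 * ∫ t in Set.Ioi 0, t ^ 6 * (deriv h t) ^ 2))

/-- FAR-FIELD SIGN (M; multipole expansion of `Ξ`): fast tails `r⁵ Ξ[h](r) → −(36/5) U₂(∞)`, power tails
`r^{2σ} Ξ[h](r) → c² Z(σ)`; in both regimes `Ξ[h] < 0` eventually (hence `κ ≢ 0` unless `h' ≡ 0`). -/
def FarFieldSign : Prop :=
  ∀ h : ℝ → ℝ, ContDiff ℝ 3 h →
    (HasFastTail h →
      Tendsto (fun r : ℝ => r ^ 5 * Xi h r) atTop
        (𝓝 (-(36 / 5) * (20 / 7 * ∫ t in Set.Ioi 0, t ^ 6 * (deriv h t) ^ 2)))) ∧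
    (∀ c σ : ℝ, HasPowerTail h c σ → Tendsto (fun r : ℝ => r ^ (2 * σ) * Xi h r) atTop (𝓝 (c ^ 2 * Zexp σ)))

/-- ORDER-TWO NORMAL FORM (L; the engine identity as a theorem about classical solutions with Newtonian pressure):
a classical NS solution on an open window whose slice at `t₀` is the `l = 2` shell has `∂ₜF(t₀) ≡ 0` and
`∂ₜ²F(t₀, x) = κ[h](‖y‖) · det(y, Qy, Q²y)`. -/
def SecondJetNormalForm : Prop :=
  ∀ (S : Set ℝ) (u : ℝ → E3 → E3) (p : ℝ → E3 → ℝ) (x₀ : E3) (Q : E3 →L[ℝ] E3) (h : ℝ → ℝ) (t₀ : ℝ),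
    IsOpen S → t₀ ∈ S →
    Literature.Analysis.FluidPDE.IsClassicalNSSolutionOn S 1 0 u p →
    (∀ t ∈ S, Tendsto (fun x : E3 => p t x / (1 + ‖x - x₀‖)) (Filter.cocompact E3) (𝓝 0)) →
    IsShapeTensor Q → ContDiff ℝ (⊤ : WithTop ℕ∞) (fun y : E3 => h ‖y‖) →
    (HasFastTail h ∨ ∃ c σ : ℝ, HasPowerTail h c σ) →
    u t₀ = shellVelocity h Q x₀ →
    ∀ x : E3, deriv (fun t => threadingFlux u x₀ t x) t₀ = 0 ∧
      iteratedDeriv 2 (fun t => threadingFlux u x₀ t x) t₀ = kappa h ‖x - x₀‖ * vandermondeCovariant Q (x - x₀)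

/-- [v2 form — interior EXACT shell slice; per V9-P1 (shared price) possibly true for lack of instances, since single-degree
exactness is not propagated to interior times; SUPERSEDED by `L2ShellRungDatum` below, kept for the record.]
THE RUNG (l = 2 case of `StubSingleDegreeRung` / `stub_singleDegreeWindow`, in contrapositive form): a classical NS
solution on an open window that is unthreaded about `x₀` at ALL times of the window cannot have a non-axisymmetric `l = 2`
shell slice with an admissible (fast or power) tail — unless the profile is constant (then the slice is the linear strain
`6h(0)·Q`, excluded in any bounded class).  v2: pressure normalised only by SUBLINEAR GROWTH (P1: the endpoint `σ = 1`, the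
bounded non-decaying shell, is now a non-empty case; there `p ↛ 0`); profile class `ω` = analytic, DELIBERATELY (P2/A1, see the
module docstring); NO runnable falsifier at rung level (A4) — falsifiers are `FarFieldSign`, `QuadrupoleMomentIdentity`, `ZexpNeg`. -/
def L2ShellRung : Prop :=
  ∀ (S : Set ℝ) (u : ℝ → E3 → E3) (p : ℝ → E3 → ℝ) (x₀ : E3) (Q : E3 →L[ℝ] E3) (h : ℝ → ℝ) (t₀ : ℝ),
    IsOpen S → t₀ ∈ S →
    Literature.Analysis.FluidPDE.IsClassicalNSSolutionOn S 1 0 u p →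
    (∀ t ∈ S, Tendsto (fun x : E3 => p t x / (1 + ‖x - x₀‖)) (Filter.cocompact E3) (𝓝 0)) →
    IsShapeTensor Q → (∃ y : E3, vandermondeCovariant Q y ≠ 0) →
    ContDiff ℝ (⊤ : WithTop ℕ∞) (fun y : E3 => h ‖y‖) → (HasFastTail h ∨ ∃ c σ : ℝ, HasPowerTail h c σ) →
    u t₀ = shellVelocity h Q x₀ →
    (∀ t ∈ S, ∀ x : E3, threadingFlux u x₀ t x = 0) →
    ∀ r : ℝ, 0 < r → deriv h r = 0

/-- THE RUNG, DATUM FORM (v3, V9-P1 shared price; L): a classical NS solution on `[t₀, t₁)` (smooth up to `t₀`), unthreaded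
about `x₀` for `t ∈ (t₀, t₁)`, whose DATUM is the non-axisymmetric `l = 2` shell (`det(y,Qy,Q²y) ≢ 0`) with an admissible tail and
sublinearly growing initial pressure, has a constant profile.  NON-VACUITY: shell DATA are freely prescribable and launch classical
solutions on a short window; the hypothesis class is NON-EMPTY — a UNIAXIAL `Q` gives an axisymmetric swirl-free datum whose
evolution stays so, unthreaded about every axis point — and the rung excludes exactly the biaxial data (instances on both sides).
Proof route: `F ≡ 0` on `[t₀,t₁)` gives the one-sided jets `∂ₜF(t₀⁺) = ∂ₜ²F(t₀⁺) = 0`; the normal form `SecondJetNormalForm` holds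
for one-sided jets at `t₀` verbatim (it only differentiates the equation at `t₀`), so `κ[h] · det(y,Qy,Q²y) ≡ 0`, `κ[h] ≡ 0`, and
`FarFieldSign` / analyticity finish as in v2. -/
def L2ShellRungDatum : Prop :=
  ∀ (u : ℝ → E3 → E3) (p : ℝ → E3 → ℝ) (x₀ : E3) (Q : E3 →L[ℝ] E3) (h : ℝ → ℝ) (t₀ t₁ : ℝ),
    t₀ < t₁ →
    Literature.Analysis.FluidPDE.IsClassicalNSSolutionOn (Set.Ico t₀ t₁) 1 0 u p →
    Tendsto (fun x : E3 => p t₀ x / (1 + ‖x - x₀‖)) (Filter.cocompact E3) (𝓝 0) →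
    IsShapeTensor Q → (∃ y : E3, vandermondeCovariant Q y ≠ 0) →
    ContDiff ℝ (⊤ : WithTop ℕ∞) (fun y : E3 => h ‖y‖) → (HasFastTail h ∨ ∃ c σ : ℝ, HasPowerTail h c σ) →
    u t₀ = shellVelocity h Q x₀ →
    (∀ t ∈ Set.Ioo t₀ t₁, ∀ x : E3, threadingFlux u x₀ t x = 0) →
    ∀ r : ℝ, 0 < r → deriv h r = 0

/-- The degree-`l` poloidal shell about `x₀` with χ-profile `h` and solid harmonic `P` (as a function `Pf`):
`u(x₀ + y) = curl curl (h(r) P(y) y) = (E(r) + b'(r)/r) P(y) y + b(r) ∇P(y)`, `E = −(h'' + 2(l+1)h'/r)`,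
`b = (l+1)h + r h'` (for `l = 2`, `Pf y = ⟪y, Qy⟫` this is `shellVelocity`). -/
noncomputable def shellVelocityDeg (l : ℕ) (h : ℝ → ℝ) (Pf : E3 → ℝ) (x₀ : E3) : E3 → E3 := fun x =>
  ((-(deriv (deriv h) ‖x - x₀‖ + 2 * (l + 1) * deriv h ‖x - x₀‖ / ‖x - x₀‖)
      + ((l + 2) * deriv h ‖x - x₀‖ + ‖x - x₀‖ * deriv (deriv h) ‖x - x₀‖) / ‖x - x₀‖) * Pf (x - x₀)) • (x - x₀)
    + ((l + 1) * h ‖x - x₀‖ + ‖x - x₀‖ * deriv h ‖x - x₀‖) • gradient Pf (x - x₀)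

/-- Toroidal-potential profile `E(r) = −(h'' + 2(l+1) h'/r)` of the degree-`l` shell (`curl u = E(r) ∇P × y`). -/
noncomputable def torProfile (l : ℕ) (h : ℝ → ℝ) (r : ℝ) : ℝ := -(deriv (deriv h) r + 2 * (l + 1) * deriv h r / r)

/-- The traceless REYNOLDS-STRESS form `M₀(v)(a,b) = ∫ (⟪v,a⟫⟪v,b⟫ − ⟪a,b⟫|v|²/3)` (= the exterior quadrupole moment of the
Newtonian pressure: `p₂^ext(x) = (3/4π) M₀(v)(x,x)/|x|⁵`, since `∫ (∂ᵢvⱼ∂ⱼvᵢ) K = 2∫ ⟪v, Kv⟫` for harmonic quadratics `K`). -/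
noncomputable def reynoldsForm (v : E3 → E3) (a b : E3) : ℝ :=
  ∫ x : E3, (inner ℝ (v x) a * inner ℝ (v x) b - inner ℝ a b * ‖v x‖ ^ 2 / 3)

/-- REYNOLDS FACTORISATION (S–M per degree, engine-verified for l = 2, 3, 4 incl. generic harmonics): the traceless Reynolds
form of a degree-`l` shell FACTORS as `(∫₀^∞ t^{2l+2} h'(t)² dt) · N(P)` with `N(P)` a constant traceless symmetric tensor
depending only on the harmonic `P` (the unique `V₂`-covariant of `Sym² V_l`); the radial factor is automatically positive. -/
def ReynoldsFactorisation : Prop :=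
  ∀ (l : ℕ) (P : MvPolynomial (Fin 3) ℝ), 2 ≤ l → P.IsHomogeneous l →
    (∀ y : E3, Laplacian.laplacian (fun z : E3 => MvPolynomial.eval (fun i => z i) P) y = 0) →
    ∃ N : E3 →L[ℝ] E3, IsShapeTensor N ∧
      ∀ h : ℝ → ℝ, ContDiff ℝ ((⊤ : ℕ∞) : WithTop ℕ∞) (fun y : E3 => h ‖y‖) → HasFastTailDeg l h →
        ∀ a b : E3, reynoldsForm (shellVelocityDeg l h (fun z : E3 => MvPolynomial.eval (fun i => z i) P) 0) a b =
          (∫ t in Set.Ioi 0, t ^ (2 * l + 2) * (deriv h t) ^ 2) * inner ℝ a (N b)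

/-- FAR-FIELD QUADRUPOLE LAW (M–L; the lever): for a classical NS solution with Newtonian pressure whose slice at `t₀` is a
degree-`l` shell with a fast tail, the order-two threading coefficient is, to leading order at spatial infinity, the pairing of
the vorticity with the Reynolds quadric: `∂ₜ²F(t₀,x) = (9/2π)|y|⁻⁵ M₀(u(t₀))(curl u(t₀) x, y) + |E(r)| r^{l−4} o(1)`. -/
def FarFieldQuadrupoleLaw : Prop :=
  ∀ (S : Set ℝ) (u : ℝ → E3 → E3) (p : ℝ → E3 → ℝ) (x₀ : E3) (l : ℕ) (P : MvPolynomial (Fin 3) ℝ) (h : ℝ → ℝ) (t₀ : ℝ),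
    IsOpen S → t₀ ∈ S →
    Literature.Analysis.FluidPDE.IsClassicalNSSolutionOn S 1 0 u p →
    (∀ t ∈ S, Tendsto (fun x : E3 => p t x / (1 + ‖x - x₀‖)) (Filter.cocompact E3) (𝓝 0)) →
    2 ≤ l → P.IsHomogeneous l →
    (∀ y : E3, Laplacian.laplacian (fun z : E3 => MvPolynomial.eval (fun i => z i) P) y = 0) →
    ContDiff ℝ ((⊤ : ℕ∞) : WithTop ℕ∞) (fun y : E3 => h ‖y‖) → HasFastTailDeg l h →
    u t₀ = shellVelocityDeg l h (fun z : E3 => MvPolynomial.eval (fun i => z i) P) x₀ →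
    ∃ ε : ℝ → ℝ, Tendsto ε atTop (𝓝 0) ∧ ∀ x : E3, 1 ≤ ‖x - x₀‖ →
      |iteratedDeriv 2 (fun t => threadingFlux u x₀ t x) t₀
          - 9 / (2 * Real.pi) * ‖x - x₀‖ ^ (-(5 : ℤ))
            * reynoldsForm (u t₀) (Literature.Analysis.FluidPDE.curl (u t₀) x) (x - x₀)|
        ≤ |torProfile l h ‖x - x₀‖| * ‖x - x₀‖ ^ ((l : ℤ) - 4) * ε ‖x - x₀‖

/-- ALGEBRAIC LEMMA of the general-degree programme (M, finite-dimensional): if a harmonic homogeneous polynomial `H` of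
degree `l ≥ 1` Poisson-commutes on spheres with a traceless symmetric quadratic form `M` (`det(y, ∇H(y), My) ≡ 0`), then
`M = 0`, or `H` is a multiple of `⟪y, My⟫` (only possible for `l = 2` or `H = 0`), or `M` is uniaxial with axis `a` and `H`
is axisymmetric about `a`. -/
def HarmonicBracketRigidity : Prop :=
  ∀ (l : ℕ) (H : MvPolynomial (Fin 3) ℝ) (M : E3 →L[ℝ] E3), 1 ≤ l → H.IsHomogeneous l →
    (∀ y : E3, Laplacian.laplacian (fun z : E3 => MvPolynomial.eval (fun i => z i) H) y = 0) →
    IsShapeTensor M →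
    (∀ y : E3, inner ℝ y (Literature.Analysis.FluidPDE.cross
        (gradient (fun z : E3 => MvPolynomial.eval (fun i => z i) H) y) (M y)) = 0) →
    M = 0 ∨ (∃ β : ℝ, ∀ y : E3, MvPolynomial.eval (fun i => y i) H = β * inner ℝ y (M y)) ∨
      ∃ (a : E3) (μ : ℝ), a ≠ 0 ∧ (∀ y : E3, M y = μ • ((3 * inner ℝ a y) • a - (inner ℝ a a) • y)) ∧
        ∀ y : E3, inner ℝ y (Literature.Analysis.FluidPDE.cross
          (gradient (fun z : E3 => MvPolynomial.eval (fun i => z i) H) y) a) = 0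

end Summit.NavierStokesRegularity.NavierStokesRegularity.Cruxes.PoloidalLiouville.ReynoldsQuadrupole
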